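import Summits.Ventures.CertifiedQuantumChemistry.Rows.T2PrimeRelaxationKernel
import HarnessLib

/-!
# Ventures/CertifiedQuantumChemistry — Rows/T2PrimeCongruence.lean: on the `S_z`-sector rows the
# printed `T2′` block is a CONGRUENCE of its `T2` block, so `T2′ ⪰ 0 ⟺ T2 ⪰ 0` there
# (rdm-A, addendum 17 §F.3, COROLLARY "`T2′ ≡ T2` by congruence", at RELAXATION level)

HONEST FRAMING (verbatim): certified bounds for a stated model Hamiltonian in a stated basis; not a
claim about the real molecule beyond that model.

Seat rdm-A (gen 56), zero compute; ROWS courtesy file (no row, no claim node, no certificate sentence,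
nothing asserted about any model; no instance, reader or FORMAT byte changes; 0 `def`). Sequel of
rdm-A's `Rows/T2PrimeRelaxationKernel.lean` (addendum 17 THEOREM F2 at relaxation level: the border
vectors `u_P = Σ_Y w_{s(Y)} e_{(P,Y,Y)} + w_{s(P)} e_P`, `w_α N_α + w_β N_β = 0`, are kernel vectors of
the printed `T2′(γ, Γ) = ( T2 X ; X† γ )` at every feasible point of the printed `S_z`-sector rows once
`Γ` obeys the two-body `S_z` selection rule, and that rule is itself forced by `T2′ ⪰ 0`). Source text:
`pub-qchem-rdm/FORMAT-qcl1-addendum-17-faces.md` §F.3, COROLLARY (congruence) — there verified in exact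
rational arithmetic on the `k = 4, 6, 10` files only ("on S: `X = −T·B` and `C = BᵀTB` … hence
`T2p_σ(y) = Pᵀ T2_σ(y) P` with `P = [ I | −B ]` … `T2p_σ(y) ⪰ 0 ⟺ T2_σ(y) ⪰ 0` for every `y ∈ S`").
In print the total-`N` shadow of the mechanism is Braams–Percus–Zhao's remark that a further one-body
operator "can be absorbed into `A`" "if `N ≥ 2`" (Adv. Chem. Phys. 134 (2007) p. 106), next to "this
`T2′` matrix should replace `T2`" (p. 108): with the `(N_α, N_β)`-resolved sector rows the border operator
`B` is absorbed as well, which is what the kernel vectors express.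

Proved here, for every `Λ`:
* `fromBlocks_eq_conj_of_border_kernel` / `posSemidef_fromBlocks_iff_of_border_kernel` (linear
  algebra, any finite index types): if a block matrix `( A X ; Xᴴ C )` with `A` Hermitian has, for
  EVERY border label `l`, a kernel vector `(b_l ; e_l)` whose border part is the unit vector `e_l`,
  then `X = −A B`, `C = Bᴴ A B` (`B = [b_l]_l`), the block matrix IS the congruence
  `[ 1 | −B ]ᴴ A [ 1 | −B ]`, and it is positive semidefinite iff its main block `A` is;
* `t2Map_isHermitian`, `t2PrimeMap_eq_fromBlocks` (bookkeeping on the printed formulas, Nakata et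
  al. 2008 §II.A–B): for Hermitian `γ, Γ` the printed `T2` functional is Hermitian and the printed
  lower-left block of `T2′` is the conjugate transpose of the upper-right one;
* **`t2PrimeMap_eq_conj_t2Map`** (addendum 17 §F.3 COROLLARY at relaxation level): at every feasible
  point of the printed `S_z`-sector DQG programme `IsDQGFeasibleSector a b γ Γ` (Mazziotti 2007 §II.F
  eqs. (87)–(90)) with `a + b ≠ 0`, for spin weights `w_α a + w_β b = 0` with `w_α, w_β ≠ 0` (these
  exist iff `N_α, N_β ≥ 1`, e.g. `w = (b, −a)`) and `Γ` obeying the two-body `S_z` selection rule,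
  `T2′(γ, Γ) = [ 1 | −B ]ᴴ · T2(γ, Γ) · [ 1 | −B ]` with the explicit
  `B_{(i,j,k), P} = [i = P] [j = k] · w_{s(j)} / w_{s(P)}` (the normalised border kernel vectors of
  `T2PrimeRelaxationKernel.lean`);
* **`t2PrimeMap_posSemidef_iff_t2Map_posSemidef`**: hence, for `a ≠ 0`, `b ≠ 0` and spin-blocked `Γ`
  on the sector rows, `T2′(γ, Γ) ⪰ 0 ⟺ T2(γ, Γ) ⪰ 0` — the border of `T2′` is redundant there;
* **`isDQGT1T2PrimeFeasibleSector_iff`**: for `a ≠ 0`, `b ≠ 0` the printed sector `PQGT1T2′`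
  feasible set (`IsDQGT1T2PrimeFeasibleSector`, Nakata et al. 2008 §II.A–C with sector rows) IS the
  set of sector-DQG-feasible pairs with `T1 ⪰ 0`, `T2 ⪰ 0` and `Γ` spin-blocked — the same subset
  of pairs, hence the same optimum for EVERY objective (`forall_isDQGT1T2PrimeFeasibleSector_iff`,
  bound form), and the spin-blocked `DQGT1T2` programme is a lower bound to the sector ground-state
  energy (`le_sectorGroundEnergy_of_forall_t1_t2_twoSpinSel`, from the tree's
  `le_sectorGroundEnergy_of_forall_isDQGT1T2PrimeFeasibleSector`).
Words only (NOT formalised here): whether spin-blocking of `Γ` is itself without loss for the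
UNPRIMED sector `T2` programme and an `S_z`-symmetric objective (a phase-averaging argument over the
spin rotation `e^{iθŜ_z}`; it would make the sector optima of `DQGT1T2` and `DQGT1T2′` equal for
spin-free integrals, cf. the closed-shell columns `PQGT1T2 = PQGT1T2′` of Nakata et al. 2008 Table I);
and the degenerate sectors `N_α = 0` or `N_β = 0`, where only half of the border is pinned.
Everything is PROVED (0 sorry, 0 def).

References: M. Nakata, B. J. Braams, K. Fujisawa, M. Fukuda, J. K. Percus, M. Yamashita, Z. Zhao,
J. Chem. Phys. 128 (2008) 164113, §II.A–B (`T2`; `T2′ = ( T2 X ; X† γ )`), §II.C (inclusions), Table I.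
[cite: NakataEtAl2008, §II.B]
D. A. Mazziotti, Adv. Chem. Phys. 134 (Wiley, 2007) 21–59, §II.F eqs. (87)–(90).
[cite: Mazziotti2007RDMChapter, §II.F eqs. (87)-(90)]
-/

noncomputable section

namespace Summit.Ventures.CertifiedQuantumChemistry

open Matrix Finset
open Literature.MathematicalPhysics.QuantumLattice Literature.MathematicalPhysics.QuantumChemistry
open scoped ComplexOrder

/-! ### Linear algebra: a full set of border kernel vectors makes a block matrix a congruence -/

section Block

variable {m n : Type*} [Fintype m] [Fintype n] [DecidableEq m] [DecidableEq n]

omit [DecidableEq m] in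
/-- Main rows of `( A X ; Y C )` against `(b_l ; e_l)`: `(A B)_{I l} + X_{I l}`. [folklore] -/
private theorem fromBlocks_mulVec_border_inl (A : Matrix m m ℂ) (X : Matrix m n ℂ)
    (Y : Matrix n m ℂ) (C : Matrix n n ℂ) (B : Matrix m n ℂ) (l : n) (I : m) :
    (fromBlocks A X Y C *ᵥ Sum.elim (fun K => B K l) (fun l' => if l' = l then (1 : ℂ) else 0))
        (Sum.inl I) = (A * B) I l + X I l := by
  rw [Matrix.fromBlocks_mulVec]
  simp only [Sum.elim_inl, Sum.elim_comp_inl, Sum.elim_comp_inr, Pi.add_apply, mulVec, dotProduct,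
    mul_apply, mul_ite, mul_one, mul_zero, Finset.sum_ite_eq', Finset.mem_univ, if_true]

omit [DecidableEq m] in
/-- Border rows of `( A X ; Y C )` against `(b_l ; e_l)`: `(Y B)_{l'' l} + C_{l'' l}`. [folklore] -/
private theorem fromBlocks_mulVec_border_inr (A : Matrix m m ℂ) (X : Matrix m n ℂ)
    (Y : Matrix n m ℂ) (C : Matrix n n ℂ) (B : Matrix m n ℂ) (l : n) (l'' : n) :
    (fromBlocks A X Y C *ᵥ Sum.elim (fun K => B K l) (fun l' => if l' = l then (1 : ℂ) else 0))
        (Sum.inr l'') = (Y * B) l'' l + C l'' l := by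
  rw [Matrix.fromBlocks_mulVec]
  simp only [Sum.elim_inr, Sum.elim_comp_inl, Sum.elim_comp_inr, Pi.add_apply, mulVec, dotProduct,
    mul_apply, mul_ite, mul_one, mul_zero, Finset.sum_ite_eq', Finset.mem_univ, if_true]

/-- **Kernel ⇒ congruence.** If the Hermitian-cornered block matrix `( A X ; Xᴴ C )` kills, for every
border label `l`, the vector `(b_l ; e_l)` (`B = [b_l]_l`), then `X = −A B`, `C = Bᴴ A B`, i.e.
`( A X ; Xᴴ C ) = [ 1 | −B ]ᴴ A [ 1 | −B ]`. [folklore] -/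
theorem fromBlocks_eq_conj_of_border_kernel {A : Matrix m m ℂ} (hA : A.IsHermitian)
    (X : Matrix m n ℂ) (C : Matrix n n ℂ) (B : Matrix m n ℂ)
    (hker : ∀ l : n,
      fromBlocks A X Xᴴ C *ᵥ Sum.elim (fun K => B K l) (fun l' => if l' = l then (1 : ℂ) else 0) = 0) :
    fromBlocks A X Xᴴ C =
      (fromCols (1 : Matrix m m ℂ) (-B))ᴴ * A * fromCols (1 : Matrix m m ℂ) (-B) := by
  have hX : X = -(A * B) := by
    ext I l
    have h := congr_fun (hker l) (Sum.inl I)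
    rw [fromBlocks_mulVec_border_inl, Pi.zero_apply] at h
    rw [Matrix.neg_apply]
    linear_combination h
  have hC : C = Bᴴ * A * B := by
    ext l'' l
    have h := congr_fun (hker l) (Sum.inr l'')
    rw [fromBlocks_mulVec_border_inr, Pi.zero_apply, hX, conjTranspose_neg, conjTranspose_mul, hA.eq,
      Matrix.neg_mul, Matrix.neg_apply] at h
    linear_combination h
  rw [hC, hX, conjTranspose_fromCols_eq_fromRows_conjTranspose, fromRows_mul, fromRows_mul_fromCols]
  simp only [conjTranspose_one, conjTranspose_neg, conjTranspose_mul, hA.eq, Matrix.one_mul,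
    Matrix.mul_one, Matrix.neg_mul, Matrix.mul_neg, neg_neg, Matrix.mul_assoc]

/-- **Hence `( A X ; Xᴴ C ) ⪰ 0 ⟺ A ⪰ 0`** under a full set of border kernel vectors: `A` is a
principal block, and conversely the whole matrix is a congruence of `A`. [folklore] -/
theorem posSemidef_fromBlocks_iff_of_border_kernel (A : Matrix m m ℂ) (X : Matrix m n ℂ)
    (C : Matrix n n ℂ) (B : Matrix m n ℂ)
    (hker : ∀ l : n,
      fromBlocks A X Xᴴ C *ᵥ Sum.elim (fun K => B K l) (fun l' => if l' = l then (1 : ℂ) else 0) = 0) :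
    (fromBlocks A X Xᴴ C).PosSemidef ↔ A.PosSemidef := by
  constructor
  · intro h
    have hsub := h.submatrix (Sum.inl : m → m ⊕ n)
    have heq : (fromBlocks A X Xᴴ C).submatrix Sum.inl Sum.inl = A := by
      ext I J
      rw [submatrix_apply, fromBlocks_apply₁₁]
    rwa [heq] at hsub
  · intro h
    rw [fromBlocks_eq_conj_of_border_kernel h.1 X C B hker]
    exact h.conjTranspose_mul_mul_same _

end Block

/-! ### Bookkeeping on the printed `T2` / `T2′` formulas (Nakata et al. 2008 §II.A–B) -/

section Abstract

variable {ι : Type*} [LinearOrder ι] [Fintype ι]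

omit [Fintype ι] in
/-- Kronecker deltas are symmetric. [folklore] -/
private theorem delta_comm (x y : ι) : (if x = y then (1 : ℂ) else 0) = if y = x then 1 else 0 := by
  rcases eq_or_ne x y with h | h
  · rw [if_pos h, if_pos h.symm]
  · rw [if_neg h, if_neg h.symm]

omit [Fintype ι] in
/-- **The printed `T2` functional of a Hermitian pair is Hermitian** (termwise on Nakata et al. 2008
§II.A: conjugating and exchanging `(ijk) ↔ (lmn)` permutes the seven terms). [cite: NakataEtAl2008, §II.A] -/
theorem t2Map_isHermitian {γ : Matrix ι ι ℂ} {Γ : Matrix (ι × ι) (ι × ι) ℂ} (hγ : γ.IsHermitian)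
    (hΓ : Γ.IsHermitian) : (t2Map γ Γ).IsHermitian := by
  refine Matrix.IsHermitian.ext fun I J => ?_
  obtain ⟨i, j, k⟩ := I
  obtain ⟨l, m, n⟩ := J
  have hd : ∀ p : Prop, ∀ _ : Decidable p, star (if p then (1 : ℂ) else 0) = if p then 1 else 0 := by
    intro p _
    split_ifs
    · exact star_one ℂ
    · exact star_zero ℂ
  rw [t2Map_apply, t2Map_apply]
  simp only [star_add, star_sub, star_mul, hd, hΓ.apply, hγ.apply]
  rw [delta_comm n k, delta_comm i l, delta_comm i m, delta_comm j l, delta_comm j m]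
  ring

omit [Fintype ι] in
/-- **The printed lower-left block of `T2′` is the conjugate transpose of the upper-right one** for
Hermitian `Γ`: `(X†)_{l,(ijk)} = Γ^{lk}_{ij} = conj Γ^{ij}_{lk}` (Nakata et al. 2008 §II.B), so
`T2′(γ, Γ) = ( T2 X ; Xᴴ γ )` literally. [cite: NakataEtAl2008, §II.B] -/
theorem t2PrimeMap_eq_fromBlocks (γ : Matrix ι ι ℂ) {Γ : Matrix (ι × ι) (ι × ι) ℂ}
    (hΓ : Γ.IsHermitian) :
    t2PrimeMap γ Γ = fromBlocks (t2Map γ Γ)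
      (Matrix.of fun (I : ι × ι × ι) (l : ι) => Γ (I.1, I.2.1) (l, I.2.2))
      (Matrix.of fun (I : ι × ι × ι) (l : ι) => Γ (I.1, I.2.1) (l, I.2.2))ᴴ γ := by
  rw [t2PrimeMap]
  congr 1
  ext l I
  rw [conjTranspose_apply, Matrix.of_apply, Matrix.of_apply]
  exact (hΓ.apply _ _).symm

end Abstract

/-! ### The congruence on the `S_z`-sector rows -/

section Sector

variable {Λ : Type*} [LinearOrder Λ] [Fintype Λ]

/-- The NORMALISED border kernel vector `(b_P ; e_P) = w_{s(P)}⁻¹ · u_P` of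
`T2PrimeRelaxationKernel.lean` is a kernel vector of `T2′(γ, Γ)` at every feasible point of the
printed `S_z`-sector DQG programme with spin-blocked `Γ` (`a + b ≠ 0`, `w_α a + w_β b = 0`,
`w_{s(P)} ≠ 0`). [cite: NakataEtAl2008, §II.B] -/
theorem t2PrimeMap_mulVec_unitBorderVec_eq_zero {a b : ℕ} {γ : Matrix (Orb Λ) (Orb Λ) ℂ}
    {Γ : Matrix (Orb Λ × Orb Λ) (Orb Λ × Orb Λ) ℂ} (h : IsDQGFeasibleSector a b γ Γ) (hab : a + b ≠ 0)
    {w : Fin 2 → ℂ} (hw : w 0 * (a : ℂ) + w 1 * (b : ℂ) = 0)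
    (hΓ : ∀ i j P k : Orb Λ,
      (ofLex i).2.val + (ofLex j).2.val ≠ (ofLex P).2.val + (ofLex k).2.val → Γ (i, j) (P, k) = 0)
    (P : Orb Λ) (hP : w (ofLex P).2 ≠ 0) :
    t2PrimeMap γ Γ *ᵥ Sum.elim
        (fun t : Orb Λ × Orb Λ × Orb Λ =>
          (w (ofLex P).2)⁻¹ * ∑ Y : Orb Λ, if t = (P, Y, Y) then w (ofLex Y).2 else 0)
        (fun l : Orb Λ => if l = P then (1 : ℂ) else 0) = 0 := by
  have hs : (Sum.elim
        (fun t : Orb Λ × Orb Λ × Orb Λ =>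
          (w (ofLex P).2)⁻¹ * ∑ Y : Orb Λ, if t = (P, Y, Y) then w (ofLex Y).2 else 0)
        (fun l : Orb Λ => if l = P then (1 : ℂ) else 0) : (Orb Λ × Orb Λ × Orb Λ) ⊕ Orb Λ → ℂ) =
      (w (ofLex P).2)⁻¹ • Sum.elim
        (fun t : Orb Λ × Orb Λ × Orb Λ => ∑ Y : Orb Λ, if t = (P, Y, Y) then w (ofLex Y).2 else 0)
        (fun l : Orb Λ => if l = P then w (ofLex P).2 else 0) := by
    funext I
    rcases I with t | l
    · rfl
    · simp only [Pi.smul_apply, Sum.elim_inr, smul_eq_mul, mul_ite, mul_zero, inv_mul_cancel₀ hP]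
  rw [hs, Matrix.mulVec_smul, t2PrimeMap_mulVec_borderVec_eq_zero_of_two_spin_sel h hab hw hΓ P,
    smul_zero]

/-- **Addendum 17 §F.3 COROLLARY (congruence) at RELAXATION level.** At every feasible point of the
printed `S_z`-sector DQG programme (`a + b ≠ 0`) with spin-blocked `Γ`, for spin weights
`w_α a + w_β b = 0`, `w_α ≠ 0`, `w_β ≠ 0` (so `N_α, N_β ≥ 1`; e.g. `w = (b, −a)`):
`T2′(γ, Γ) = [ 1 | −B ]ᴴ · T2(γ, Γ) · [ 1 | −B ]` with
`B_{K, P} = w_{s(P)}⁻¹ Σ_Y [K = (P,Y,Y)] w_{s(Y)}` — "on S: `X = −T·B`, `C = BᵀTB`, hence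
`T2p = Pᵀ T2 P` with `P = [ I | −B ]`". [cite: NakataEtAl2008, §II.B] -/
theorem t2PrimeMap_eq_conj_t2Map {a b : ℕ} {γ : Matrix (Orb Λ) (Orb Λ) ℂ}
    {Γ : Matrix (Orb Λ × Orb Λ) (Orb Λ × Orb Λ) ℂ} (h : IsDQGFeasibleSector a b γ Γ) (hab : a + b ≠ 0)
    {w : Fin 2 → ℂ} (hw : w 0 * (a : ℂ) + w 1 * (b : ℂ) = 0) (hw0 : w 0 ≠ 0) (hw1 : w 1 ≠ 0)
    (hΓ : ∀ i j P k : Orb Λ,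
      (ofLex i).2.val + (ofLex j).2.val ≠ (ofLex P).2.val + (ofLex k).2.val → Γ (i, j) (P, k) = 0) :
    t2PrimeMap γ Γ =
      (fromCols (1 : Matrix (Orb Λ × Orb Λ × Orb Λ) (Orb Λ × Orb Λ × Orb Λ) ℂ)
          (-Matrix.of fun (K : Orb Λ × Orb Λ × Orb Λ) (P : Orb Λ) =>
            (w (ofLex P).2)⁻¹ * ∑ Y : Orb Λ, if K = (P, Y, Y) then w (ofLex Y).2 else 0))ᴴ *
        t2Map γ Γ *
        fromCols (1 : Matrix (Orb Λ × Orb Λ × Orb Λ) (Orb Λ × Orb Λ × Orb Λ) ℂ)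
          (-Matrix.of fun (K : Orb Λ × Orb Λ × Orb Λ) (P : Orb Λ) =>
            (w (ofLex P).2)⁻¹ * ∑ Y : Orb Λ, if K = (P, Y, Y) then w (ofLex Y).2 else 0) := by
  have hΓh : Γ.IsHermitian := h.dqg.d_psd.1
  have hwσ : ∀ σ : Fin 2, w σ ≠ 0 := Fin.forall_fin_two.mpr ⟨hw0, hw1⟩
  rw [t2PrimeMap_eq_fromBlocks γ hΓh]
  refine fromBlocks_eq_conj_of_border_kernel (t2Map_isHermitian h.dqg.herm_one hΓh) _ γ _ fun P => ?_
  rw [← t2PrimeMap_eq_fromBlocks γ hΓh]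
  exact t2PrimeMap_mulVec_unitBorderVec_eq_zero h hab hw hΓ P (hwσ _)

/-- **`T2′ ⪰ 0 ⟺ T2 ⪰ 0` on the `S_z`-sector rows with `N_α, N_β ≥ 1` and spin-blocked `Γ`.**
At every feasible point of the printed `S_z`-sector DQG programme with `a ≠ 0`, `b ≠ 0` and `Γ`
obeying the two-body `S_z` selection rule, the printed `T2′(γ, Γ)` is positive semidefinite iff its
principal `T2` block is: the border of `T2′` is pinned by the kernel vectors (`w = (b, −a)`).
Addendum 17 §F.3: "`T2p_σ(y) ⪰ 0 ⟺ T2_σ(y) ⪰ 0` for every `y ∈ S`". [cite: NakataEtAl2008, §II.B] -/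
theorem t2PrimeMap_posSemidef_iff_t2Map_posSemidef {a b : ℕ} {γ : Matrix (Orb Λ) (Orb Λ) ℂ}
    {Γ : Matrix (Orb Λ × Orb Λ) (Orb Λ × Orb Λ) ℂ} (h : IsDQGFeasibleSector a b γ Γ) (ha : a ≠ 0)
    (hb : b ≠ 0)
    (hΓ : ∀ i j P k : Orb Λ,
      (ofLex i).2.val + (ofLex j).2.val ≠ (ofLex P).2.val + (ofLex k).2.val → Γ (i, j) (P, k) = 0) :
    (t2PrimeMap γ Γ).PosSemidef ↔ (t2Map γ Γ).PosSemidef := by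
  have hab : a + b ≠ 0 := by omega
  have hw : (![(b : ℂ), -(a : ℂ)] : Fin 2 → ℂ) 0 * (a : ℂ) +
      (![(b : ℂ), -(a : ℂ)] : Fin 2 → ℂ) 1 * (b : ℂ) = 0 := by
    rw [Matrix.cons_val_zero, Matrix.cons_val_one, Matrix.cons_val_zero]
    ring
  have hw0 : (![(b : ℂ), -(a : ℂ)] : Fin 2 → ℂ) 0 ≠ 0 := by
    rw [Matrix.cons_val_zero]
    exact_mod_cast hb
  have hw1 : (![(b : ℂ), -(a : ℂ)] : Fin 2 → ℂ) 1 ≠ 0 := by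
    rw [Matrix.cons_val_one, Matrix.cons_val_zero, neg_ne_zero]
    exact_mod_cast ha
  have hwσ : ∀ σ : Fin 2, (![(b : ℂ), -(a : ℂ)] : Fin 2 → ℂ) σ ≠ 0 :=
    Fin.forall_fin_two.mpr ⟨hw0, hw1⟩
  have hΓh : Γ.IsHermitian := h.dqg.d_psd.1
  rw [t2PrimeMap_eq_fromBlocks γ hΓh]
  refine posSemidef_fromBlocks_iff_of_border_kernel _ _ γ
    (Matrix.of fun (K : Orb Λ × Orb Λ × Orb Λ) (P : Orb Λ) =>
      ((![(b : ℂ), -(a : ℂ)] : Fin 2 → ℂ) (ofLex P).2)⁻¹ *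
        ∑ Y : Orb Λ, if K = (P, Y, Y) then (![(b : ℂ), -(a : ℂ)] : Fin 2 → ℂ) (ofLex Y).2 else 0)
    fun P => ?_
  rw [← t2PrimeMap_eq_fromBlocks γ hΓh]
  exact t2PrimeMap_mulVec_unitBorderVec_eq_zero h hab hw hΓ P (hwσ _)

/-- **The printed sector `PQGT1T2′` feasible set, for `N_α, N_β ≥ 1`, IS the spin-blocked sector
`PQGT1T2` feasible set**: `IsDQGT1T2PrimeFeasibleSector a b γ Γ` (Nakata et al. 2008 §II.A–C with
the sector rows of Mazziotti 2007 §II.F) holds iff `(γ, Γ)` is sector-DQG-feasible with `T1 ⪰ 0`,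
`T2 ⪰ 0` and `Γ` obeying the two-body `S_z` selection rule (`⇒`: `T2` is a principal block and the
selection rule is forced, `two_spin_sel_of_isDQGT1T2PrimeFeasibleSector`; `⇐`: the congruence).
[cite: NakataEtAl2008, §II.A-C] -/
theorem isDQGT1T2PrimeFeasibleSector_iff {a b : ℕ} (ha : a ≠ 0) (hb : b ≠ 0)
    {γ : Matrix (Orb Λ) (Orb Λ) ℂ} {Γ : Matrix (Orb Λ × Orb Λ) (Orb Λ × Orb Λ) ℂ} :
    IsDQGT1T2PrimeFeasibleSector a b γ Γ ↔
      IsDQGFeasibleSector a b γ Γ ∧ (t1Map γ Γ).PosSemidef ∧ (t2Map γ Γ).PosSemidef ∧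
        ∀ i j P k : Orb Λ, (ofLex i).2.val + (ofLex j).2.val ≠ (ofLex P).2.val + (ofLex k).2.val →
          Γ (i, j) (P, k) = 0 := by
  have hab : a + b ≠ 0 := by omega
  constructor
  · intro h
    exact ⟨h.toIsDQGFeasibleSector, h.t1_psd, h.isDQGT1T2PrimeFeasible.t2Map_posSemidef,
      fun i j P k hs => two_spin_sel_of_isDQGT1T2PrimeFeasibleSector h hab i j P k hs⟩
  · rintro ⟨hS, hT1, hT2, hΓ⟩
    exact { toIsDQGFeasibleSector := hS, t1_psd := hT1,
            t2Prime_psd := (t2PrimeMap_posSemidef_iff_t2Map_posSemidef hS ha hb hΓ).mpr hT2 }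

/-- **Same optimum for every objective** (bound form): for `N_α, N_β ≥ 1` a number lies below a
functional on the printed sector `PQGT1T2′` feasible set iff it lies below it on the spin-blocked
sector `PQGT1T2` feasible set — the border coordinates of `T2′` are redundant faces on these rows
(addendum 17 §F.3: "the feasible sets … are EQUAL; so are the optima, for every objective").
[cite: NakataEtAl2008, §II.C] -/
theorem forall_isDQGT1T2PrimeFeasibleSector_iff {a b : ℕ} (ha : a ≠ 0) (hb : b ≠ 0)
    {E : Matrix (Orb Λ) (Orb Λ) ℂ → Matrix (Orb Λ × Orb Λ) (Orb Λ × Orb Λ) ℂ → ℝ} {c : ℝ} :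
    (∀ γ Γ, IsDQGT1T2PrimeFeasibleSector a b γ Γ → c ≤ E γ Γ) ↔
      ∀ γ Γ, IsDQGFeasibleSector a b γ Γ → (t1Map γ Γ).PosSemidef → (t2Map γ Γ).PosSemidef →
        (∀ i j P k : Orb Λ, (ofLex i).2.val + (ofLex j).2.val ≠ (ofLex P).2.val + (ofLex k).2.val →
          Γ (i, j) (P, k) = 0) → c ≤ E γ Γ := by
  constructor
  · intro hc γ Γ hS hT1 hT2 hΓ
    exact hc γ Γ ((isDQGT1T2PrimeFeasibleSector_iff ha hb).mpr ⟨hS, hT1, hT2, hΓ⟩)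
  · intro hc γ Γ h
    obtain ⟨hS, hT1, hT2, hΓ⟩ := (isDQGT1T2PrimeFeasibleSector_iff ha hb).mp h
    exact hc γ Γ hS hT1 hT2 hΓ

/-- **The spin-blocked sector `DQGT1T2` programme (no border) is a lower bound to the sector
ground-state energy**: for Hermitian integral data, `a, b ≤ |Λ|`, `a + b ≠ 0`, if `c` lies below the
energy functional on every sector-DQG-feasible pair with `T1 ⪰ 0`, `T2 ⪰ 0` and spin-blocked `Γ`, then
`c ≤ E₀(Ĥ; N_α = a, N_β = b)` — every sector `PQGT1T2′`-feasible pair is such a pair, and the tree's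
`le_sectorGroundEnergy_of_forall_isDQGT1T2PrimeFeasibleSector` applies (Nakata et al. 2008 §II.C,
`E_PQGT1T2 ≤ E_PQGT1T2′ ≤ E_fullCI`). [cite: NakataEtAl2008, §II.C] -/
theorem le_sectorGroundEnergy_of_forall_t1_t2_twoSpinSel {h : Λ → Λ → ℂ}
    {g : Λ → Λ → Λ → Λ → ℂ} {hnuc : ℂ} (hH : (molecularHamiltonian h g hnuc).IsHermitian) {a b : ℕ}
    (ha : a ≤ Fintype.card Λ) (hb : b ≤ Fintype.card Λ) (hab : a + b ≠ 0) {c : ℝ}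
    (hc : ∀ γ Γ, IsDQGFeasibleSector a b γ Γ → (t1Map γ Γ).PosSemidef → (t2Map γ Γ).PosSemidef →
      (∀ i j P k : Orb Λ, (ofLex i).2.val + (ofLex j).2.val ≠ (ofLex P).2.val + (ofLex k).2.val →
        Γ (i, j) (P, k) = 0) → c ≤ (rdmEnergy h g hnuc γ Γ).re) :
    c ≤ sectorGroundEnergy (molecularHamiltonian h g hnuc) a b :=
  le_sectorGroundEnergy_of_forall_isDQGT1T2PrimeFeasibleSector hH ha hb fun γ Γ hF =>
    hc γ Γ hF.toIsDQGFeasibleSector hF.t1_psd hF.isDQGT1T2PrimeFeasible.t2Map_posSemidef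
      fun i j P k hs => two_spin_sel_of_isDQGT1T2PrimeFeasibleSector hF hab i j P k hs

end Sector

end Summit.Ventures.CertifiedQuantumChemistry

end
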